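import Summits.ValiantsHypothesis.ValiantsHypothesis.Theorems.KPlusLogSqLawTropicalBFourFourOrderTypeLawLEXT0
import Summits.ValiantsHypothesis.ValiantsHypothesis.Theorems.KPlusLogSqLawTropicalBFourFourOrderTypeLawLEXT1
import Summits.ValiantsHypothesis.ValiantsHypothesis.Theorems.KPlusLogSqLawTropicalBFourFourOrderTypeLawLEXT2
import Summits.ValiantsHypothesis.ValiantsHypothesis.Theorems.KPlusLogSqLawTropicalBFourFourOrderTypeLawLEXT3
import Summits.ValiantsHypothesis.ValiantsHypothesis.Theorems.KPlusLogSqLawTropicalBFourFourOrderTypeLawLEXT4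
import Summits.ValiantsHypothesis.ValiantsHypothesis.Theorems.KPlusLogSqLawTropicalBFourFourOrderTypeLawLEXT5
import Summits.ValiantsHypothesis.ValiantsHypothesis.Theorems.KPlusLogSqLawTropicalBFourFourOrderTypeLawLEXT6
import Summits.ValiantsHypothesis.ValiantsHypothesis.Theorems.KPlusLogSqLawTropicalBFourFourOrderTypeLawLEXT7
import Summits.ValiantsHypothesis.ValiantsHypothesis.Theorems.KPlusLogSqLawTropicalBFourFourOrderTypeLawLEXT8
import Summits.ValiantsHypothesis.ValiantsHypothesis.Theorems.KPlusLogSqLawTropicalBFourFourOrderTypeLawLEXT9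
import Summits.ValiantsHypothesis.ValiantsHypothesis.Theorems.KPlusLogSqLawTropicalBFourFourOrderTypeLawLEXT10
import Summits.ValiantsHypothesis.ValiantsHypothesis.Theorems.KPlusLogSqLawTropicalBFourFourOrderTypeLawLEXT11
import Summits.ValiantsHypothesis.ValiantsHypothesis.Theorems.KPlusLogSqLawTropicalBFourFourOrderTypeLawLEXT12
import Summits.ValiantsHypothesis.ValiantsHypothesis.Theorems.KPlusLogSqLawTropicalBFourFourOrderTypeLawLEXT13
import Summits.ValiantsHypothesis.ValiantsHypothesis.Theorems.KPlusLogSqLawTropicalBFourFourOrderTypeLawLEXT14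
import Summits.ValiantsHypothesis.ValiantsHypothesis.Theorems.KPlusLogSqLawTropicalBFourFourOrderTypeLawLEXT15
import Summits.ValiantsHypothesis.ValiantsHypothesis.Theorems.KPlusLogSqLawTropicalBFourFourOrderTypeLawLEXT16
import Summits.ValiantsHypothesis.ValiantsHypothesis.Theorems.KPlusLogSqLawTropicalBFourFourOrderTypeLawLEXT17
import Summits.ValiantsHypothesis.ValiantsHypothesis.Theorems.KPlusLogSqLawTropicalBFourFourOrderTypeLawLEXT18
import Summits.ValiantsHypothesis.ValiantsHypothesis.Theorems.KPlusLogSqLawTropicalBFourFourOrderTypeLawLEXT19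
import Summits.ValiantsHypothesis.ValiantsHypothesis.Theorems.KPlusLogSqLawTropicalBFourFourOrderTypeLawLEXT20
import Summits.ValiantsHypothesis.ValiantsHypothesis.Theorems.KPlusLogSqLawTropicalBFourFourOrderTypeLawLEXT21
import Summits.ValiantsHypothesis.ValiantsHypothesis.Theorems.KPlusLogSqLawTropicalBFourFourOrderTypeLawLEXT22
import Summits.ValiantsHypothesis.ValiantsHypothesis.Theorems.KPlusLogSqLawTropicalBFourFourOrderTypeLawLEXT23
import Summits.ValiantsHypothesis.ValiantsHypothesis.Theorems.KPlusLogSqLawTropicalBFourFourOrderTypeLawA44RDefs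

/-!
# Route «KPlusLogSqLaw», crux `TropicalB` (stmt-ValiantsHypothesis-19771) — `(4,4)` ORDER-TYPE LAW LEX (assembly):
# on the FAST-DIGIT cell `4(d 1 − d 0) ≤ d 2 − d 0`, `4(d 2 − d 0) ≤ d 3 − d 0` the `(4,4)` cell is NOT counting-tight — `T_D(4,4; d) ≤ 33 < 34 = T(4,4)`

HONEST FRAMING.  Census-structure helper toward the crux `Summit.ValiantsHypothesis.ValiantsHypothesis.Theses.KPlusLogSqLaw.TropicalB` (item
`stmt-ValiantsHypothesis-19771`, route `KPlusLogSqLaw`; cell `pub-symmetroid`, seat val-sym-trop-p5 g13, 2026-08-28; `--supports … --as helper`).  A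
finite statement about `4 × 4` designs with four slope classes; nothing here bears on `TropicalB` in its window, `WeakLifting`, the doors,
`MatrixDescartes` (stmt-ValiantsHypothesis-18050) or VP ≠ VNP.

THE LAW (`designRowD_four_four_33_LEX`).  For every `d : Fin 4 → ℕ` with `4 * d 2 ≤ 3 * d 0 + d 3`, `d 0 ≤ d 1`, `4 * d 1 ≤ 3 * d 0 + d 2` and the strict slope
order `4 * d 2 < 3 * d 1 + d 3`, `3 * d 1 < 2 * d 0 + d 2` of the three core histograms (automatic in the interior of the cell), every chain of unique
optima of a `(4,4)` design with exponents `d` at strictly increasing integer slopes with distinct consecutive terms has `n ≤ 33` — one below the slope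
count `C(7,3) − 1 = 34 = T(4,4)` (attained on the «blob» cells, e.g. `(0,6,15,19)`, `census_four_four_exact`).  So in the fast-digit (lexicographic) regime the
third slope class does NOT buy the full count already at `m = 4` (at `m = 3` the fast-digit cell IS tight: `T_D(3,4; (0,1,4,13)) = 19`).  MECHANISM: the core
`0040 ≺ 0301 ≺ 2011` is refuted in 24 branches (`…LEXT*`, one `decide +kernel` each; 360 region-uniform Farkas certificates
in total), assembled with `refute_mono` / `refute_cons_of_forall` / `refute1_of_refute` of the `(4,4)` kit (`…FourFourOrderKit`, `…FourFourOrderSearch`,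
val-sym-trop-p5 g12).  [this cell; the decision procedure `ktight` and the certificate pipeline are in HOME/val-sym-trop-p5/g13/]
-/

set_option linter.dupNamespace false
set_option autoImplicit false

namespace Summit.ValiantsHypothesis.ValiantsHypothesis.Theorems.KPlusLogSqLaw

namespace FourFourCore

open ThreeFourCore (form comb form_comb form_sub form_ite)
open Summit.ValiantsHypothesis.ValiantsHypothesis.Theorems.MatrixDescartes.Negative
open Summit.ValiantsHypothesis.ValiantsHypothesis.Theorems.LacunarySymmetroidMatrixDescartes.TropicalCensus
open Finset

/-- the union of the branch tables (right-nested). -/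
def tab_LEX : List Cert := tab_LEX_0 ++ (tab_LEX_1 ++ (tab_LEX_2 ++ (tab_LEX_3 ++ (tab_LEX_4 ++ (tab_LEX_5 ++ (tab_LEX_6 ++ (tab_LEX_7 ++ (tab_LEX_8 ++ (tab_LEX_9 ++ (tab_LEX_10 ++ (tab_LEX_11 ++ (tab_LEX_12 ++ (tab_LEX_13 ++ (tab_LEX_14 ++ (tab_LEX_15 ++ (tab_LEX_16 ++ (tab_LEX_17 ++ (tab_LEX_18 ++ (tab_LEX_19 ++ (tab_LEX_20 ++ (tab_LEX_21 ++ (tab_LEX_22 ++ (tab_LEX_23)))))))))))))))))))))))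

/-- branch 0 lifted to the union table. -/
theorem rb_LEX_0 : refute Gneg_LEX G_LEX tab_LEX [anchor_LEX, (![1, 2, 3, 0], ![1, 1, 1, 3])] rest_LEX = true :=
  refute_mono Gneg_LEX G_LEX tab_LEX_0 tab_LEX (fun pre h => by unfold tab_LEX; exact certFor_append G_LEX _ _ pre h) _ _ refuted_LEX_0

/-- branch 1 lifted to the union table. -/
theorem rb_LEX_1 : refute Gneg_LEX G_LEX tab_LEX [anchor_LEX, (![1, 2, 3, 0], ![1, 1, 3, 1])] rest_LEX = true :=
  refute_mono Gneg_LEX G_LEX tab_LEX_1 tab_LEX (fun pre h => by unfold tab_LEX; exact certFor_append_left G_LEX _ _ pre (certFor_append G_LEX _ _ pre h)) _ _ refuted_LEX_1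

/-- branch 2 lifted to the union table. -/
theorem rb_LEX_2 : refute Gneg_LEX G_LEX tab_LEX [anchor_LEX, (![1, 2, 3, 0], ![1, 3, 1, 1])] rest_LEX = true :=
  refute_mono Gneg_LEX G_LEX tab_LEX_2 tab_LEX (fun pre h => by unfold tab_LEX; exact certFor_append_left G_LEX _ _ pre (certFor_append_left G_LEX _ _ pre (certFor_append G_LEX _ _ pre h))) _ _ refuted_LEX_2

/-- branch 3 lifted to the union table. -/
theorem rb_LEX_3 : refute Gneg_LEX G_LEX tab_LEX [anchor_LEX, (![1, 2, 3, 0], ![3, 1, 1, 1])] rest_LEX = true :=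
  refute_mono Gneg_LEX G_LEX tab_LEX_3 tab_LEX (fun pre h => by unfold tab_LEX; exact certFor_append_left G_LEX _ _ pre (certFor_append_left G_LEX _ _ pre (certFor_append_left G_LEX _ _ pre (certFor_append G_LEX _ _ pre h)))) _ _ refuted_LEX_3

/-- branch 4 lifted to the union table. -/
theorem rb_LEX_4 : refute Gneg_LEX G_LEX tab_LEX [anchor_LEX, (![1, 3, 0, 2], ![1, 1, 1, 3])] rest_LEX = true :=
  refute_mono Gneg_LEX G_LEX tab_LEX_4 tab_LEX (fun pre h => by unfold tab_LEX; exact certFor_append_left G_LEX _ _ pre (certFor_append_left G_LEX _ _ pre (certFor_append_left G_LEX _ _ pre (certFor_append_left G_LEX _ _ pre (certFor_append G_LEX _ _ pre h))))) _ _ refuted_LEX_4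

/-- branch 5 lifted to the union table. -/
theorem rb_LEX_5 : refute Gneg_LEX G_LEX tab_LEX [anchor_LEX, (![1, 3, 0, 2], ![1, 1, 3, 1])] rest_LEX = true :=
  refute_mono Gneg_LEX G_LEX tab_LEX_5 tab_LEX (fun pre h => by unfold tab_LEX; exact certFor_append_left G_LEX _ _ pre (certFor_append_left G_LEX _ _ pre (certFor_append_left G_LEX _ _ pre (certFor_append_left G_LEX _ _ pre (certFor_append_left G_LEX _ _ pre (certFor_append G_LEX _ _ pre h)))))) _ _ refuted_LEX_5

/-- branch 6 lifted to the union table. -/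
theorem rb_LEX_6 : refute Gneg_LEX G_LEX tab_LEX [anchor_LEX, (![1, 3, 0, 2], ![1, 3, 1, 1])] rest_LEX = true :=
  refute_mono Gneg_LEX G_LEX tab_LEX_6 tab_LEX (fun pre h => by unfold tab_LEX; exact certFor_append_left G_LEX _ _ pre (certFor_append_left G_LEX _ _ pre (certFor_append_left G_LEX _ _ pre (certFor_append_left G_LEX _ _ pre (certFor_append_left G_LEX _ _ pre (certFor_append_left G_LEX _ _ pre (certFor_append G_LEX _ _ pre h))))))) _ _ refuted_LEX_6

/-- branch 7 lifted to the union table. -/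
theorem rb_LEX_7 : refute Gneg_LEX G_LEX tab_LEX [anchor_LEX, (![1, 3, 0, 2], ![3, 1, 1, 1])] rest_LEX = true :=
  refute_mono Gneg_LEX G_LEX tab_LEX_7 tab_LEX (fun pre h => by unfold tab_LEX; exact certFor_append_left G_LEX _ _ pre (certFor_append_left G_LEX _ _ pre (certFor_append_left G_LEX _ _ pre (certFor_append_left G_LEX _ _ pre (certFor_append_left G_LEX _ _ pre (certFor_append_left G_LEX _ _ pre (certFor_append_left G_LEX _ _ pre (certFor_append G_LEX _ _ pre h)))))))) _ _ refuted_LEX_7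

/-- branch 8 lifted to the union table. -/
theorem rb_LEX_8 : refute Gneg_LEX G_LEX tab_LEX [anchor_LEX, (![2, 0, 3, 1], ![1, 1, 1, 3])] rest_LEX = true :=
  refute_mono Gneg_LEX G_LEX tab_LEX_8 tab_LEX (fun pre h => by unfold tab_LEX; exact certFor_append_left G_LEX _ _ pre (certFor_append_left G_LEX _ _ pre (certFor_append_left G_LEX _ _ pre (certFor_append_left G_LEX _ _ pre (certFor_append_left G_LEX _ _ pre (certFor_append_left G_LEX _ _ pre (certFor_append_left G_LEX _ _ pre (certFor_append_left G_LEX _ _ pre (certFor_append G_LEX _ _ pre h))))))))) _ _ refuted_LEX_8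

/-- branch 9 lifted to the union table. -/
theorem rb_LEX_9 : refute Gneg_LEX G_LEX tab_LEX [anchor_LEX, (![2, 0, 3, 1], ![1, 1, 3, 1])] rest_LEX = true :=
  refute_mono Gneg_LEX G_LEX tab_LEX_9 tab_LEX (fun pre h => by unfold tab_LEX; exact certFor_append_left G_LEX _ _ pre (certFor_append_left G_LEX _ _ pre (certFor_append_left G_LEX _ _ pre (certFor_append_left G_LEX _ _ pre (certFor_append_left G_LEX _ _ pre (certFor_append_left G_LEX _ _ pre (certFor_append_left G_LEX _ _ pre (certFor_append_left G_LEX _ _ pre (certFor_append_left G_LEX _ _ pre (certFor_append G_LEX _ _ pre h)))))))))) _ _ refuted_LEX_9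

/-- branch 10 lifted to the union table. -/
theorem rb_LEX_10 : refute Gneg_LEX G_LEX tab_LEX [anchor_LEX, (![2, 0, 3, 1], ![1, 3, 1, 1])] rest_LEX = true :=
  refute_mono Gneg_LEX G_LEX tab_LEX_10 tab_LEX (fun pre h => by unfold tab_LEX; exact certFor_append_left G_LEX _ _ pre (certFor_append_left G_LEX _ _ pre (certFor_append_left G_LEX _ _ pre (certFor_append_left G_LEX _ _ pre (certFor_append_left G_LEX _ _ pre (certFor_append_left G_LEX _ _ pre (certFor_append_left G_LEX _ _ pre (certFor_append_left G_LEX _ _ pre (certFor_append_left G_LEX _ _ pre (certFor_append_left G_LEX _ _ pre (certFor_append G_LEX _ _ pre h))))))))))) _ _ refuted_LEX_10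

/-- branch 11 lifted to the union table. -/
theorem rb_LEX_11 : refute Gneg_LEX G_LEX tab_LEX [anchor_LEX, (![2, 0, 3, 1], ![3, 1, 1, 1])] rest_LEX = true :=
  refute_mono Gneg_LEX G_LEX tab_LEX_11 tab_LEX (fun pre h => by unfold tab_LEX; exact certFor_append_left G_LEX _ _ pre (certFor_append_left G_LEX _ _ pre (certFor_append_left G_LEX _ _ pre (certFor_append_left G_LEX _ _ pre (certFor_append_left G_LEX _ _ pre (certFor_append_left G_LEX _ _ pre (certFor_append_left G_LEX _ _ pre (certFor_append_left G_LEX _ _ pre (certFor_append_left G_LEX _ _ pre (certFor_append_left G_LEX _ _ pre (certFor_append_left G_LEX _ _ pre (certFor_append G_LEX _ _ pre h)))))))))))) _ _ refuted_LEX_11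

/-- branch 12 lifted to the union table. -/
theorem rb_LEX_12 : refute Gneg_LEX G_LEX tab_LEX [anchor_LEX, (![2, 3, 1, 0], ![1, 1, 1, 3])] rest_LEX = true :=
  refute_mono Gneg_LEX G_LEX tab_LEX_12 tab_LEX (fun pre h => by unfold tab_LEX; exact certFor_append_left G_LEX _ _ pre (certFor_append_left G_LEX _ _ pre (certFor_append_left G_LEX _ _ pre (certFor_append_left G_LEX _ _ pre (certFor_append_left G_LEX _ _ pre (certFor_append_left G_LEX _ _ pre (certFor_append_left G_LEX _ _ pre (certFor_append_left G_LEX _ _ pre (certFor_append_left G_LEX _ _ pre (certFor_append_left G_LEX _ _ pre (certFor_append_left G_LEX _ _ pre (certFor_append_left G_LEX _ _ pre (certFor_append G_LEX _ _ pre h))))))))))))) _ _ refuted_LEX_12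

/-- branch 13 lifted to the union table. -/
theorem rb_LEX_13 : refute Gneg_LEX G_LEX tab_LEX [anchor_LEX, (![2, 3, 1, 0], ![1, 1, 3, 1])] rest_LEX = true :=
  refute_mono Gneg_LEX G_LEX tab_LEX_13 tab_LEX (fun pre h => by unfold tab_LEX; exact certFor_append_left G_LEX _ _ pre (certFor_append_left G_LEX _ _ pre (certFor_append_left G_LEX _ _ pre (certFor_append_left G_LEX _ _ pre (certFor_append_left G_LEX _ _ pre (certFor_append_left G_LEX _ _ pre (certFor_append_left G_LEX _ _ pre (certFor_append_left G_LEX _ _ pre (certFor_append_left G_LEX _ _ pre (certFor_append_left G_LEX _ _ pre (certFor_append_left G_LEX _ _ pre (certFor_append_left G_LEX _ _ pre (certFor_append_left G_LEX _ _ pre (certFor_append G_LEX _ _ pre h)))))))))))))) _ _ refuted_LEX_13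

/-- branch 14 lifted to the union table. -/
theorem rb_LEX_14 : refute Gneg_LEX G_LEX tab_LEX [anchor_LEX, (![2, 3, 1, 0], ![1, 3, 1, 1])] rest_LEX = true :=
  refute_mono Gneg_LEX G_LEX tab_LEX_14 tab_LEX (fun pre h => by unfold tab_LEX; exact certFor_append_left G_LEX _ _ pre (certFor_append_left G_LEX _ _ pre (certFor_append_left G_LEX _ _ pre (certFor_append_left G_LEX _ _ pre (certFor_append_left G_LEX _ _ pre (certFor_append_left G_LEX _ _ pre (certFor_append_left G_LEX _ _ pre (certFor_append_left G_LEX _ _ pre (certFor_append_left G_LEX _ _ pre (certFor_append_left G_LEX _ _ pre (certFor_append_left G_LEX _ _ pre (certFor_append_left G_LEX _ _ pre (certFor_append_left G_LEX _ _ pre (certFor_append_left G_LEX _ _ pre (certFor_append G_LEX _ _ pre h))))))))))))))) _ _ refuted_LEX_14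

/-- branch 15 lifted to the union table. -/
theorem rb_LEX_15 : refute Gneg_LEX G_LEX tab_LEX [anchor_LEX, (![2, 3, 1, 0], ![3, 1, 1, 1])] rest_LEX = true :=
  refute_mono Gneg_LEX G_LEX tab_LEX_15 tab_LEX (fun pre h => by unfold tab_LEX; exact certFor_append_left G_LEX _ _ pre (certFor_append_left G_LEX _ _ pre (certFor_append_left G_LEX _ _ pre (certFor_append_left G_LEX _ _ pre (certFor_append_left G_LEX _ _ pre (certFor_append_left G_LEX _ _ pre (certFor_append_left G_LEX _ _ pre (certFor_append_left G_LEX _ _ pre (certFor_append_left G_LEX _ _ pre (certFor_append_left G_LEX _ _ pre (certFor_append_left G_LEX _ _ pre (certFor_append_left G_LEX _ _ pre (certFor_append_left G_LEX _ _ pre (certFor_append_left G_LEX _ _ pre (certFor_append_left G_LEX _ _ pre (certFor_append G_LEX _ _ pre h)))))))))))))))) _ _ refuted_LEX_15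

/-- branch 16 lifted to the union table. -/
theorem rb_LEX_16 : refute Gneg_LEX G_LEX tab_LEX [anchor_LEX, (![3, 0, 1, 2], ![1, 1, 1, 3])] rest_LEX = true :=
  refute_mono Gneg_LEX G_LEX tab_LEX_16 tab_LEX (fun pre h => by unfold tab_LEX; exact certFor_append_left G_LEX _ _ pre (certFor_append_left G_LEX _ _ pre (certFor_append_left G_LEX _ _ pre (certFor_append_left G_LEX _ _ pre (certFor_append_left G_LEX _ _ pre (certFor_append_left G_LEX _ _ pre (certFor_append_left G_LEX _ _ pre (certFor_append_left G_LEX _ _ pre (certFor_append_left G_LEX _ _ pre (certFor_append_left G_LEX _ _ pre (certFor_append_left G_LEX _ _ pre (certFor_append_left G_LEX _ _ pre (certFor_append_left G_LEX _ _ pre (certFor_append_left G_LEX _ _ pre (certFor_append_left G_LEX _ _ pre (certFor_append_left G_LEX _ _ pre (certFor_append G_LEX _ _ pre h))))))))))))))))) _ _ refuted_LEX_16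

/-- branch 17 lifted to the union table. -/
theorem rb_LEX_17 : refute Gneg_LEX G_LEX tab_LEX [anchor_LEX, (![3, 0, 1, 2], ![1, 1, 3, 1])] rest_LEX = true :=
  refute_mono Gneg_LEX G_LEX tab_LEX_17 tab_LEX (fun pre h => by unfold tab_LEX; exact certFor_append_left G_LEX _ _ pre (certFor_append_left G_LEX _ _ pre (certFor_append_left G_LEX _ _ pre (certFor_append_left G_LEX _ _ pre (certFor_append_left G_LEX _ _ pre (certFor_append_left G_LEX _ _ pre (certFor_append_left G_LEX _ _ pre (certFor_append_left G_LEX _ _ pre (certFor_append_left G_LEX _ _ pre (certFor_append_left G_LEX _ _ pre (certFor_append_left G_LEX _ _ pre (certFor_append_left G_LEX _ _ pre (certFor_append_left G_LEX _ _ pre (certFor_append_left G_LEX _ _ pre (certFor_append_left G_LEX _ _ pre (certFor_append_left G_LEX _ _ pre (certFor_append_left G_LEX _ _ pre (certFor_append G_LEX _ _ pre h)))))))))))))))))) _ _ refuted_LEX_17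

/-- branch 18 lifted to the union table. -/
theorem rb_LEX_18 : refute Gneg_LEX G_LEX tab_LEX [anchor_LEX, (![3, 0, 1, 2], ![1, 3, 1, 1])] rest_LEX = true :=
  refute_mono Gneg_LEX G_LEX tab_LEX_18 tab_LEX (fun pre h => by unfold tab_LEX; exact certFor_append_left G_LEX _ _ pre (certFor_append_left G_LEX _ _ pre (certFor_append_left G_LEX _ _ pre (certFor_append_left G_LEX _ _ pre (certFor_append_left G_LEX _ _ pre (certFor_append_left G_LEX _ _ pre (certFor_append_left G_LEX _ _ pre (certFor_append_left G_LEX _ _ pre (certFor_append_left G_LEX _ _ pre (certFor_append_left G_LEX _ _ pre (certFor_append_left G_LEX _ _ pre (certFor_append_left G_LEX _ _ pre (certFor_append_left G_LEX _ _ pre (certFor_append_left G_LEX _ _ pre (certFor_append_left G_LEX _ _ pre (certFor_append_left G_LEX _ _ pre (certFor_append_left G_LEX _ _ pre (certFor_append_left G_LEX _ _ pre (certFor_append G_LEX _ _ pre h))))))))))))))))))) _ _ refuted_LEX_18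

/-- branch 19 lifted to the union table. -/
theorem rb_LEX_19 : refute Gneg_LEX G_LEX tab_LEX [anchor_LEX, (![3, 0, 1, 2], ![3, 1, 1, 1])] rest_LEX = true :=
  refute_mono Gneg_LEX G_LEX tab_LEX_19 tab_LEX (fun pre h => by unfold tab_LEX; exact certFor_append_left G_LEX _ _ pre (certFor_append_left G_LEX _ _ pre (certFor_append_left G_LEX _ _ pre (certFor_append_left G_LEX _ _ pre (certFor_append_left G_LEX _ _ pre (certFor_append_left G_LEX _ _ pre (certFor_append_left G_LEX _ _ pre (certFor_append_left G_LEX _ _ pre (certFor_append_left G_LEX _ _ pre (certFor_append_left G_LEX _ _ pre (certFor_append_left G_LEX _ _ pre (certFor_append_left G_LEX _ _ pre (certFor_append_left G_LEX _ _ pre (certFor_append_left G_LEX _ _ pre (certFor_append_left G_LEX _ _ pre (certFor_append_left G_LEX _ _ pre (certFor_append_left G_LEX _ _ pre (certFor_append_left G_LEX _ _ pre (certFor_append_left G_LEX _ _ pre (certFor_append G_LEX _ _ pre h)))))))))))))))))))) _ _ refuted_LEX_19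

/-- branch 20 lifted to the union table. -/
theorem rb_LEX_20 : refute Gneg_LEX G_LEX tab_LEX [anchor_LEX, (![3, 2, 0, 1], ![1, 1, 1, 3])] rest_LEX = true :=
  refute_mono Gneg_LEX G_LEX tab_LEX_20 tab_LEX (fun pre h => by unfold tab_LEX; exact certFor_append_left G_LEX _ _ pre (certFor_append_left G_LEX _ _ pre (certFor_append_left G_LEX _ _ pre (certFor_append_left G_LEX _ _ pre (certFor_append_left G_LEX _ _ pre (certFor_append_left G_LEX _ _ pre (certFor_append_left G_LEX _ _ pre (certFor_append_left G_LEX _ _ pre (certFor_append_left G_LEX _ _ pre (certFor_append_left G_LEX _ _ pre (certFor_append_left G_LEX _ _ pre (certFor_append_left G_LEX _ _ pre (certFor_append_left G_LEX _ _ pre (certFor_append_left G_LEX _ _ pre (certFor_append_left G_LEX _ _ pre (certFor_append_left G_LEX _ _ pre (certFor_append_left G_LEX _ _ pre (certFor_append_left G_LEX _ _ pre (certFor_append_left G_LEX _ _ pre (certFor_append_left G_LEX _ _ pre (certFor_append G_LEX _ _ pre h))))))))))))))))))))) _ _ refuted_LEX_20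

/-- branch 21 lifted to the union table. -/
theorem rb_LEX_21 : refute Gneg_LEX G_LEX tab_LEX [anchor_LEX, (![3, 2, 0, 1], ![1, 1, 3, 1])] rest_LEX = true :=
  refute_mono Gneg_LEX G_LEX tab_LEX_21 tab_LEX (fun pre h => by unfold tab_LEX; exact certFor_append_left G_LEX _ _ pre (certFor_append_left G_LEX _ _ pre (certFor_append_left G_LEX _ _ pre (certFor_append_left G_LEX _ _ pre (certFor_append_left G_LEX _ _ pre (certFor_append_left G_LEX _ _ pre (certFor_append_left G_LEX _ _ pre (certFor_append_left G_LEX _ _ pre (certFor_append_left G_LEX _ _ pre (certFor_append_left G_LEX _ _ pre (certFor_append_left G_LEX _ _ pre (certFor_append_left G_LEX _ _ pre (certFor_append_left G_LEX _ _ pre (certFor_append_left G_LEX _ _ pre (certFor_append_left G_LEX _ _ pre (certFor_append_left G_LEX _ _ pre (certFor_append_left G_LEX _ _ pre (certFor_append_left G_LEX _ _ pre (certFor_append_left G_LEX _ _ pre (certFor_append_left G_LEX _ _ pre (certFor_append_left G_LEX _ _ pre (certFor_append G_LEX _ _ pre h)))))))))))))))))))))) _ _ refuted_LEX_21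

/-- branch 22 lifted to the union table. -/
theorem rb_LEX_22 : refute Gneg_LEX G_LEX tab_LEX [anchor_LEX, (![3, 2, 0, 1], ![1, 3, 1, 1])] rest_LEX = true :=
  refute_mono Gneg_LEX G_LEX tab_LEX_22 tab_LEX (fun pre h => by unfold tab_LEX; exact certFor_append_left G_LEX _ _ pre (certFor_append_left G_LEX _ _ pre (certFor_append_left G_LEX _ _ pre (certFor_append_left G_LEX _ _ pre (certFor_append_left G_LEX _ _ pre (certFor_append_left G_LEX _ _ pre (certFor_append_left G_LEX _ _ pre (certFor_append_left G_LEX _ _ pre (certFor_append_left G_LEX _ _ pre (certFor_append_left G_LEX _ _ pre (certFor_append_left G_LEX _ _ pre (certFor_append_left G_LEX _ _ pre (certFor_append_left G_LEX _ _ pre (certFor_append_left G_LEX _ _ pre (certFor_append_left G_LEX _ _ pre (certFor_append_left G_LEX _ _ pre (certFor_append_left G_LEX _ _ pre (certFor_append_left G_LEX _ _ pre (certFor_append_left G_LEX _ _ pre (certFor_append_left G_LEX _ _ pre (certFor_append_left G_LEX _ _ pre (certFor_append_left G_LEX _ _ pre (certFor_append G_LEX _ _ pre h)))))))))))))))))))))))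 _ _ refuted_LEX_22

/-- branch 23 lifted to the union table. -/
theorem rb_LEX_23 : refute Gneg_LEX G_LEX tab_LEX [anchor_LEX, (![3, 2, 0, 1], ![3, 1, 1, 1])] rest_LEX = true :=
  refute_mono Gneg_LEX G_LEX tab_LEX_23 tab_LEX (fun pre h => by unfold tab_LEX; exact certFor_append_left G_LEX _ _ pre (certFor_append_left G_LEX _ _ pre (certFor_append_left G_LEX _ _ pre (certFor_append_left G_LEX _ _ pre (certFor_append_left G_LEX _ _ pre (certFor_append_left G_LEX _ _ pre (certFor_append_left G_LEX _ _ pre (certFor_append_left G_LEX _ _ pre (certFor_append_left G_LEX _ _ pre (certFor_append_left G_LEX _ _ pre (certFor_append_left G_LEX _ _ pre (certFor_append_left G_LEX _ _ pre (certFor_append_left G_LEX _ _ pre (certFor_append_left G_LEX _ _ pre (certFor_append_left G_LEX _ _ pre (certFor_append_left G_LEX _ _ pre (certFor_append_left G_LEX _ _ pre (certFor_append_left G_LEX _ _ pre (certFor_append_left G_LEX _ _ pre (certFor_append_left G_LEX _ _ pre (certFor_append_left G_LEX _ _ pre (certFor_append_left G_LEX _ _ pre (certFor_append_left G_LEX _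 _ pre (h)))))))))))))))))))))))) _ _ refuted_LEX_23

/-- **the kernel search for core LEX**, assembled from its 24 live branches (dead candidates by the pairwise law). -/
theorem refuted_LEX : refute1 Gneg_LEX G_LEX tab_LEX pat_LEX = true := by
  refine refute1_of_refute Gneg_LEX G_LEX tab_LEX ![2, 2, 2, 2] _ _ filter_first_LEX ?_
  refine refute_cons_of_forall Gneg_LEX G_LEX tab_LEX _ _ _ fun t ht => ?_
  have hb := List.all_eq_true.mp cands_second_LEX t ht
  rw [Bool.or_eq_true, decide_eq_true_eq] at hb
  rcases hb with hmem | hdead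
  · simp only [branches_LEX, List.mem_cons, List.not_mem_nil, or_false] at hmem
    rcases hmem with rfl | rfl | rfl | rfl | rfl | rfl | rfl | rfl | rfl | rfl | rfl | rfl | rfl | rfl | rfl | rfl | rfl | rfl | rfl | rfl | rfl | rfl | rfl | rfl
    · exact Or.inr (Or.inr rb_LEX_0)
    · exact Or.inr (Or.inr rb_LEX_1)
    · exact Or.inr (Or.inr rb_LEX_2)
    · exact Or.inr (Or.inr rb_LEX_3)
    · exact Or.inr (Or.inr rb_LEX_4)
    · exact Or.inr (Or.inr rb_LEX_5)
    · exact Or.inr (Or.inr rb_LEX_6)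
    · exact Or.inr (Or.inr rb_LEX_7)
    · exact Or.inr (Or.inr rb_LEX_8)
    · exact Or.inr (Or.inr rb_LEX_9)
    · exact Or.inr (Or.inr rb_LEX_10)
    · exact Or.inr (Or.inr rb_LEX_11)
    · exact Or.inr (Or.inr rb_LEX_12)
    · exact Or.inr (Or.inr rb_LEX_13)
    · exact Or.inr (Or.inr rb_LEX_14)
    · exact Or.inr (Or.inr rb_LEX_15)
    · exact Or.inr (Or.inr rb_LEX_16)
    · exact Or.inr (Or.inr rb_LEX_17)
    · exact Or.inr (Or.inr rb_LEX_18)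
    · exact Or.inr (Or.inr rb_LEX_19)
    · exact Or.inr (Or.inr rb_LEX_20)
    · exact Or.inr (Or.inr rb_LEX_21)
    · exact Or.inr (Or.inr rb_LEX_22)
    · exact Or.inr (Or.inr rb_LEX_23)
  · exact Or.inl hdead

/-- **CORE LEX IS FORBIDDEN ON ITS REGION.** -/
theorem core_LEX (d : Fin 4 → ℕ) (hG1 : 4 * d 2 ≤ 3 * d 0 + d 3) (hG2 : d 0 ≤ d 1) (hG3 : 4 * d 1 ≤ 3 * d 0 + d 2)
    (v ε : Fin 4 → Fin 4 → Fin 4 → ℤ) (fut : List (ℤ × RT)) (hF : List.Forall₂ (fun f h => histA f.2.2 = h) fut pat_LEX)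
    (hdom : ∀ a ∈ fut, IsDominant d v ε a.1 a.2) (hpw : fut.Pairwise (fun a b => a.1 < b.1)) : False := by
  refine not_realised_of_refute1 d v ε Gneg_LEX G_LEX tab_LEX ?_ ?_ ?_ ?_ pat_LEX refuted_LEX fut hF hdom hpw
  · intro g hg
    simp only [Gneg_LEX, List.mem_cons, List.mem_nil_iff, or_false] at hg
    rcases hg with rfl | rfl | rfl | rfl | rfl | rfl | rfl | rfl | rfl | rfl | rfl | rfl <;> simp [form, Fin.sum_univ_four] <;> omega
  · simp [G_LEX, form, Fin.sum_univ_four]; omega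
  · simp [G_LEX, form, Fin.sum_univ_four]; omega
  · simp [G_LEX, form, Fin.sum_univ_four]; omega

/-- **THE `(4,4)` ROW IS NOT COUNTING-TIGHT ON THE FAST-DIGIT CELL (core LEX).** -/
theorem designRowD_four_four_33_LEX (d : Fin 4 → ℕ) (hG1 : 4 * d 2 ≤ 3 * d 0 + d 3) (hG2 : d 0 ≤ d 1) (hG3 : 4 * d 1 ≤ 3 * d 0 + d 2)
    (hS1 : 4 * d 2 < 3 * d 1 + d 3) (hS2 : 3 * d 1 < 2 * d 0 + d 2) (v ε : Fin 4 → Fin 4 → Fin 4 → ℤ) : DesignRowD d v ε 33 := by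
  classical
  intro n θ p hθ hdom hne
  by_contra hn
  push Not at hn
  obtain ⟨hsm, hsurj⟩ := ParityLaw.classSym_surjective_of_full d v ε θ p hθ hdom hne
    (by rw [show Nat.multichoose 4 4 = 35 by rw [Nat.multichoose_eq]; decide]; omega)
  obtain ⟨kA, hkA⟩ := hsurj (classSym ((1 : Equiv.Perm (Fin 4)), ![2, 2, 2, 2]))
  obtain ⟨kB, hkB⟩ := hsurj (classSym ((1 : Equiv.Perm (Fin 4)), ![3, 1, 1, 1]))
  obtain ⟨kC, hkC⟩ := hsurj (classSym ((1 : Equiv.Perm (Fin 4)), ![3, 2, 0, 0]))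
  have eA : histA (p kA).2 = ![0, 0, 4, 0] := by rw [histA4_eq_of_classSym_eq hkA.symm]; decide
  have eB : histA (p kB).2 = ![0, 3, 0, 1] := by rw [histA4_eq_of_classSym_eq hkB.symm]; decide
  have eC : histA (p kC).2 = ![2, 0, 1, 1] := by rw [histA4_eq_of_classSym_eq hkC.symm]; decide
  have sA : Summit.ValiantsHypothesis.ValiantsHypothesis.Theorems.LacunarySymmetroidMatrixDescartes.TropicalCensus.slope d (p kA) = 4 * (d 2 : ℤ) := by
    rw [slope_eq_form, eA]; simp [form, Fin.sum_univ_four]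
  have sB : Summit.ValiantsHypothesis.ValiantsHypothesis.Theorems.LacunarySymmetroidMatrixDescartes.TropicalCensus.slope d (p kB) = 3 * (d 1 : ℤ) + (d 3 : ℤ) := by
    rw [slope_eq_form, eB]; simp [form, Fin.sum_univ_four]
  have sC : Summit.ValiantsHypothesis.ValiantsHypothesis.Theorems.LacunarySymmetroidMatrixDescartes.TropicalCensus.slope d (p kC) = 2 * (d 0 : ℤ) + (d 2 : ℤ) + (d 3 : ℤ) := by
    rw [slope_eq_form, eC]; simp [form, Fin.sum_univ_four]
  have hAB : kA < kB := hsm.lt_iff_lt.mp (by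
    show Summit.ValiantsHypothesis.ValiantsHypothesis.Theorems.LacunarySymmetroidMatrixDescartes.TropicalCensus.slope d (p kA) < Summit.ValiantsHypothesis.ValiantsHypothesis.Theorems.LacunarySymmetroidMatrixDescartes.TropicalCensus.slope d (p kB); rw [sA, sB]; omega)
  have hBC : kB < kC := hsm.lt_iff_lt.mp (by
    show Summit.ValiantsHypothesis.ValiantsHypothesis.Theorems.LacunarySymmetroidMatrixDescartes.TropicalCensus.slope d (p kB) < Summit.ValiantsHypothesis.ValiantsHypothesis.Theorems.LacunarySymmetroidMatrixDescartes.TropicalCensus.slope d (p kC); rw [sB, sC]; omega)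
  refine core_LEX d hG1 hG2 hG3 v ε [(θ kA, p kA), (θ kB, p kB), (θ kC, p kC)] ?_ ?_ ?_
  · simp only [pat_LEX]
    exact List.Forall₂.cons eA (List.Forall₂.cons eB (List.Forall₂.cons eC List.Forall₂.nil))
  · intro a ha
    simp only [List.mem_cons, List.mem_nil_iff, or_false] at ha
    rcases ha with rfl | rfl | rfl <;> exact hdom _
  · have h1 := hθ hAB; have h2 := hθ hBC
    simp only [List.pairwise_cons, List.mem_cons, or_false, forall_eq_or_imp, forall_eq, List.Pairwise.nil,
      and_true, List.not_mem_nil, IsEmpty.forall_iff, implies_true]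
    exact ⟨⟨h1, by linarith⟩, h2⟩

/-- signed form. -/
theorem four_four_le_33_signed_LEX (d : Fin 4 → ℕ) (hG1 : 4 * d 2 ≤ 3 * d 0 + d 3) (hG2 : d 0 ≤ d 1) (hG3 : 4 * d 1 ≤ 3 * d 0 + d 2)
    (hS1 : 4 * d 2 < 3 * d 1 + d 3) (hS2 : 3 * d 1 < 2 * d 0 + d 2) (v ε : Fin 4 → Fin 4 → Fin 4 → ℤ) (n : ℕ) (θ : Fin (n + 1) → ℤ)
    (p : Fin (n + 1) → RT) (hθ : StrictMono θ) (hdom : ∀ k, IsDominant d v ε (θ k) (p k))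
    (halt : ∀ k : Fin n, termSign ε (p k.castSucc) * termSign ε (p k.succ) < 0) : n ≤ 33 := by
  refine designRowD_four_four_33_LEX d hG1 hG2 hG3 hS1 hS2 v ε n θ p hθ hdom fun k h => ?_
  have := halt k
  rw [h] at this
  exact absurd this (not_lt.mpr (mul_self_nonneg _))

/-- the instance `(0, 1, 5, 25)`. -/
theorem designRowD_four_four_33_LEX_example (v ε : Fin 4 → Fin 4 → Fin 4 → ℤ) : DesignRowD ![0, 1, 5, 25] v ε 33 :=
  designRowD_four_four_33_LEX _ (by decide) (by decide) (by decide) (by decide) (by decide) v ε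

/-- a second instance deep in the cell, `(0, 1, 7, 40)`. -/
theorem designRowD_four_four_33_LEX_example' (v ε : Fin 4 → Fin 4 → Fin 4 → ℤ) : DesignRowD ![0, 1, 7, 40] v ε 33 :=
  designRowD_four_four_33_LEX _ (by decide) (by decide) (by decide) (by decide) (by decide) v ε

end FourFourCore

end Summit.ValiantsHypothesis.ValiantsHypothesis.Theorems.KPlusLogSqLaw
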